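import Summits.NavierStokesRegularity.FluidComputer.PalasekTowerGermHostSuperposedFaces
import Summits.NavierStokesRegularity.FluidComputer.PalasekTowerSuperposedRun
import Summits.NavierStokesRegularity.FluidComputer.PalasekTowerGermHostFreeRun
import Summits.NavierStokesRegularity.FluidComputer.PalasekTowerGermHostCompanionFar
import Literature.Analysis.FluidPDE.LoopCirculation

/-!
# The germ host, SUPERPOSITION DOOR (the dynamic companion rule): a strict-slot carrier and ANY
# far-away amplifier whose OWN free run meets the first-window letter give, together, a strict-slot
# design whose free run meets the letter

Cell `ns-blowup`, seat `ns-blowup-ecbridge-3` (g7; D-0074 GROUP C «BRIDGE SUPPORT», lineage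
`host_preparation`; bears_on LADDER-NS N1, route `PalasekTowerBreakdown`, crux `EpisodeBase` = item
stmt-NavierStokesRegularity-19179, line `slot` v5). LABEL: E–C typing + kernel analysis (theorems only;
no definition, no named fact, no `sorry`). WHAT THIS IS NOT: not Navier–Stokes evidence — no free run
meeting the letter is exhibited; the theorem says what ONE free run of an amplifier (plus one tame free run
of a carrier) would give. Nothing about `RungG 1` or blow-up.

## Why (HOLDER-CENSUS-19179 §6, K124 (c2), the companion rule of g4)

The static companion rule (`LevelZeroData.exists_add_translate`, GermHostCompanionFar) says: a strict-slot
carrier `U₁` plus ANY smooth compactly supported divergence-free amplifier `W` of speed `< Y₀`, placed far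
enough, is again a strict-slot filler `U₁ + W(· − c)` — the level-`0` register gadgets are supplied by
the carrier. The FREE-RUN DOOR (g6, `palasekTowerBreakdown_episodeBase_of_levelZeroData_freeRun`) then asks
for ONE free run of the COMPOSITE meeting the first-window letter. This file decouples the composite's run
into the two separate runs (`SuperposedRun.exists_free_run_near_superposed`): for `‖c‖` large (chosen IN
THE KERNEL) the composite's free run is uniformly sup-close on the window — and `C¹`/circulation-close at
`τfirst` — to `v₁ + v₂(· − c)`, `v₁`, `v₂` the free runs of `U₁` and `W`. Hence:

* `LevelZeroData.exists_superposed_freeRun` — if the carrier's free run stays under the cap with margin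
  `η` and the amplifier's free run stays under the cap and meets the three level-`1` faces with margin `η`
  inside `‖x‖ ≤ R` (its own frame), then for every `‖c‖ ≥ r₀` the composite `U₁ + W(· − c)` is a strict-slot
  filler of radius `‖c‖ + R` AND has a free classical finite-energy run on `[1, τfirst]` meeting the letter
  with margin `η/2` inside `‖x‖ ≤ ‖c‖ + R`.

So the mechanism `W` needs NO level-`0` readouts: compact support, smoothness, `div W = 0`, speed `< Y₀`,
and ITS OWN free run reaching the level-`1` faces — the `𝔄`-meter's object (OPT-𝔄-1) by name.
References: S. Palasek, arXiv:2605.13827 §3.3–§4 [cite: Palasek2026ElementaryModel, §4]; T. Tao, Anal. PDE 6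
(2013) Thm. 5.4 [cite: Tao2011, Thm. 5.4 (ii)+(iv)]; J. Leray, Acta Math. 63 (1934) §19
[cite: Leray1934, §19 (3.4)–(3.8)]; G. H. Hardy, J. E. Littlewood, G. Pólya, *Inequalities* §8
[cite: HardyLittlewoodPolya1952, §8 (Landau's inequality)].
-/

noncomputable section

namespace Summit.NavierStokesRegularity.FluidComputer.PalasekTowerClayBridge.Germ

open Set Function Filter Topology InnerProductSpace Metric MeasureTheory
open scoped Topology ContDiff RealInnerProductSpace ENNReal NNReal
open Literature.Analysis Literature.Analysis.FluidPDE

variable {U₁ W : EuclideanSpace ℝ (Fin 3) → EuclideanSpace ℝ (Fin 3)} {ρ₁ R : ℝ}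

/-- **THE SUPERPOSITION DOOR (dynamic companion rule).** Let `h₁ : LevelZeroData U₁ ρ₁` be a strict-slot
carrier and `W` a smooth divergence-free amplifier with `tsupport W ⊆ B̄(0, R)` (`R ≥ 0`) and speed
`< Y₀`. Let `(v₁, q₁)` be a classical finite-energy FREE run (`ν = 1`) on `[1, Host.τfirst]` from
`v₁ 1 = U₁` with `‖v₁‖ ≤ (5/3) Y₁ − η`, and `(v₂, q₂)` a classical finite-energy FREE run on `[1, Host.τfirst]`
from `v₂ 1 = W` with `‖v₂‖ ≤ (5/3) Y₁ − η` which at `Host.τfirst`, inside `‖x‖ ≤ R`, shows `Y₁ + η ≤ ‖v₂‖`,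
`A₁ + η ≤ ‖Dv₂‖` and an `N₁`-core loop of circulation `≥ N₁^{β−2} + η` (`η > 0`). Then there is `r₀` such
that for every `‖c‖ ≥ r₀`: `U₁ + W(· − c)` fills the strict slot with radius `‖c‖ + R`, and the UNFORCED
system has a classical finite-energy solution on `[1, Host.τfirst]` from `U₁ + W(· − c)` below
`(5/3) Y₁ − η/2`, showing at `Host.τfirst` inside `‖x‖ ≤ ‖c‖ + R` the three level-`1` faces with margin
`η/2`. [cite: Palasek2026ElementaryModel, §4] [cite: Tao2011, Thm. 5.4 (ii)+(iv)]
[cite: Leray1934, §19 (3.4)–(3.8)] -/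
theorem LevelZeroData.exists_superposed_freeRun (h₁ : LevelZeroData U₁ ρ₁)
    (hW : ContDiff ℝ ∞ W) (hdivW : VectorCalculus.IsDivFree W) (hWsupp : tsupport W ⊆ closedBall 0 R)
    (hWlt : ∀ x, ‖W x‖ < TowerRates.wide.Y 0) (hR : 0 ≤ R)
    {v₁ : ℝ → EuclideanSpace ℝ (Fin 3) → EuclideanSpace ℝ (Fin 3)} {q₁ : ℝ → EuclideanSpace ℝ (Fin 3) → ℝ}
    (hv₁ : IsClassicalNSSolutionOn (Icc 1 Host.τfirst) 1 0 v₁ q₁) (hv₁1 : v₁ 1 = U₁)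
    (hv₁E : ∃ C : ℝ≥0∞, C < ⊤ ∧ ∀ t ∈ Icc (1 : ℝ) Host.τfirst, ∫⁻ x, ‖v₁ t x‖ₑ ^ 2 ≤ C)
    {v₂ : ℝ → EuclideanSpace ℝ (Fin 3) → EuclideanSpace ℝ (Fin 3)} {q₂ : ℝ → EuclideanSpace ℝ (Fin 3) → ℝ}
    (hv₂ : IsClassicalNSSolutionOn (Icc 1 Host.τfirst) 1 0 v₂ q₂) (hv₂1 : v₂ 1 = W)
    (hv₂E : ∃ C : ℝ≥0∞, C < ⊤ ∧ ∀ t ∈ Icc (1 : ℝ) Host.τfirst, ∫⁻ x, ‖v₂ t x‖ₑ ^ 2 ≤ C)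
    {η : ℝ} (hη : 0 < η)
    (hcap₁ : ∀ t ∈ Icc (1 : ℝ) Host.τfirst, ∀ x, ‖v₁ t x‖ ≤ 5 / 3 * TowerRates.wide.Y 1 - η)
    (hcap₂ : ∀ t ∈ Icc (1 : ℝ) Host.τfirst, ∀ x, ‖v₂ t x‖ ≤ 5 / 3 * TowerRates.wide.Y 1 - η)
    (hspeed : ∃ x, ‖x‖ ≤ R ∧ TowerRates.wide.Y 1 + η ≤ ‖v₂ Host.τfirst x‖)
    (hstrain : ∃ x, ‖x‖ ≤ R ∧ TowerRates.wide.A 1 + η ≤ ‖fderiv ℝ (v₂ Host.τfirst) x‖)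
    (hcore : ∃ (x : EuclideanSpace ℝ (Fin 3)) (γ : ℝ → EuclideanSpace ℝ (Fin 3)),
      ‖x‖ ≤ R ∧ ContDiff ℝ 1 γ ∧ γ 0 = γ 1 ∧
      (∀ s ∈ Icc (0 : ℝ) 1, γ s ∈ closedBall x (1 / TowerRates.wide.N 1)) ∧
      (∀ s ∈ Icc (0 : ℝ) 1, ‖deriv γ s‖ ≤ 8 * Real.pi / TowerRates.wide.N 1) ∧
      TowerRates.wide.N 1 ^ (TowerRates.wide.β - 2) + η ≤ circulation (v₂ Host.τfirst) γ) :
    ∃ r₀ : ℝ, ∀ c : EuclideanSpace ℝ (Fin 3), r₀ ≤ ‖c‖ →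
      LevelZeroData (U₁ + fun x => W (x - c)) (‖c‖ + R) ∧
      ∃ (u : ℝ → EuclideanSpace ℝ (Fin 3) → EuclideanSpace ℝ (Fin 3)) (p : ℝ → EuclideanSpace ℝ (Fin 3) → ℝ),
        IsClassicalNSSolutionOn (Icc 1 Host.τfirst) 1 0 u p ∧ (u 1 = U₁ + fun x => W (x - c)) ∧
        (∃ C : ℝ≥0∞, C < ⊤ ∧ ∀ t ∈ Icc (1 : ℝ) Host.τfirst, ∫⁻ x, ‖u t x‖ₑ ^ 2 ≤ C) ∧
        (∀ t ∈ Icc (1 : ℝ) Host.τfirst, ∀ x, ‖u t x‖ ≤ 5 / 3 * TowerRates.wide.Y 1 - η / 2) ∧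
        (∃ x, ‖x‖ ≤ ‖c‖ + R ∧ TowerRates.wide.Y 1 + η / 2 ≤ ‖u Host.τfirst x‖) ∧
        (∃ x, ‖x‖ ≤ ‖c‖ + R ∧ TowerRates.wide.A 1 + η / 2 ≤ ‖fderiv ℝ (u Host.τfirst) x‖) ∧
        (∃ (x : EuclideanSpace ℝ (Fin 3)) (γ : ℝ → EuclideanSpace ℝ (Fin 3)),
          ‖x‖ ≤ ‖c‖ + R ∧ ContDiff ℝ 1 γ ∧ γ 0 = γ 1 ∧
          (∀ s ∈ Icc (0 : ℝ) 1, γ s ∈ closedBall x (1 / TowerRates.wide.N 1)) ∧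
          (∀ s ∈ Icc (0 : ℝ) 1, ‖deriv γ s‖ ≤ 8 * Real.pi / TowerRates.wide.N 1) ∧
          TowerRates.wide.N 1 ^ (TowerRates.wide.β - 2) + η / 2 ≤ circulation (u Host.τfirst) γ) := by
  -- ### the window `[0, Wd]` in shifted time, the cap `M`
  set Wd : ℝ := Host.wfirst with hWd_def
  have hWd : 0 < Wd := Host.wfirst_pos
  have hτ : Host.τfirst = 1 + Wd := Host.τfirst_eq
  set M : ℝ := 5 / 3 * TowerRates.wide.Y 1 with hM_def
  have hY1 : 0 < TowerRates.wide.Y 1 := Real.rpow_pos_of_pos (TowerRates.wide.N_pos 1) _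
  have hM : 0 < M := by positivity
  have hN1 : 0 < TowerRates.wide.N 1 := TowerRates.wide.N_pos 1
  set L : ℝ := 8 * Real.pi / TowerRates.wide.N 1 with hL_def
  have hL0 : 0 ≤ L := by positivity
  -- `M − η > 0` (the amplifier's run reaches `Y₁ + η` under the cap `M − η`)
  have hMη : 0 < M - η := by
    obtain ⟨x, -, hx⟩ := hspeed
    have h1 := hcap₂ Host.τfirst ⟨by rw [hτ]; linarith, le_rfl⟩ x
    linarith
  -- ### the shifted free runs on `[0, Wd]`
  have hmemW : ∀ {t : ℝ}, t ∈ Icc 0 Wd → t + 1 ∈ Icc (1 : ℝ) Host.τfirst := fun ht =>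
    ⟨by linarith [ht.1], by rw [hτ]; linarith [ht.2]⟩
  have hv₁' : IsClassicalNSSolutionOn (Icc 0 Wd) 1 0 (fun t => v₁ (t + 1)) (fun t => q₁ (t + 1)) :=
    (hv₁.comp_add_right 1).mono (fun t ht => hmemW ht) (uniqueDiffOn_Icc hWd)
  have hv₂' : IsClassicalNSSolutionOn (Icc 0 Wd) 1 0 (fun t => v₂ (t + 1)) (fun t => q₂ (t + 1)) :=
    (hv₂.comp_add_right 1).mono (fun t ht => hmemW ht) (uniqueDiffOn_Icc hWd)
  have hv₁'E : ∃ C : ℝ≥0∞, C < ⊤ ∧ ∀ t ∈ Icc 0 Wd, ∫⁻ x, ‖v₁ (t + 1) x‖ₑ ^ 2 ≤ C := by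
    obtain ⟨C, hC, hb⟩ := hv₁E
    exact ⟨C, hC, fun t ht => hb (t + 1) (hmemW ht)⟩
  have hv₂'E : ∃ C : ℝ≥0∞, C < ⊤ ∧ ∀ t ∈ Icc 0 Wd, ∫⁻ x, ‖v₂ (t + 1) x‖ₑ ^ 2 ≤ C := by
    obtain ⟨C, hC, hb⟩ := hv₂E
    exact ⟨C, hC, fun t ht => hb (t + 1) (hmemW ht)⟩
  have hv₁'bd : ∀ t ∈ Icc 0 Wd, ∀ x, ‖v₁ (t + 1) x‖ ≤ M - η := fun t ht x => hcap₁ (t + 1) (hmemW ht) x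
  have hv₂'bd : ∀ t ∈ Icc 0 Wd, ∀ x, ‖v₂ (t + 1) x‖ ≤ M - η := fun t ht x => hcap₂ (t + 1) (hmemW ht) x
  have hv₁'M : ∀ t ∈ Icc 0 Wd, ∀ x, ‖v₁ (t + 1) x‖ ≤ M + 1 / 2 := fun t ht x =>
    (hv₁'bd t ht x).trans (by linarith)
  have hv₂'M : ∀ t ∈ Icc 0 Wd, ∀ x, ‖v₂ (t + 1) x‖ ≤ M + 1 / 2 := fun t ht x =>
    (hv₂'bd t ht x).trans (by linarith)
  have hv₁'0 : (fun t : ℝ => v₁ (t + 1)) 0 = U₁ := by simp only [zero_add, hv₁1]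
  have hv₂'0 : (fun t : ℝ => v₂ (t + 1)) 0 = W := by simp only [zero_add, hv₂1]
  -- data vanish at infinity (compact support)
  have hdec₁ : ∀ η' : ℝ, 0 < η' → ∃ Rr : ℝ, ∀ y, Rr ≤ ‖y‖ → ‖(fun t : ℝ => v₁ (t + 1)) 0 y‖ ≤ η' := by
    intro η' hη'; rw [hv₁'0]; exact decay_of_tsupport_subset h₁.support η' hη'
  have hdec₂ : ∀ η' : ℝ, 0 < η' → ∃ Rr : ℝ, ∀ y, Rr ≤ ‖y‖ → ‖(fun t : ℝ => v₂ (t + 1)) 0 y‖ ≤ η' := by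
    intro η' hη'; rw [hv₂'0]; exact decay_of_tsupport_subset hWsupp η' hη'
  have hW0 : HasRapidSpatialDecay W := HasRapidSpatialDecay.of_hasCompactSupport hW
    ((isCompact_closedBall (0 : EuclideanSpace ℝ (Fin 3)) R).of_isClosed_subset (isClosed_tsupport W) hWsupp)
  have hv₂'0' : HasRapidSpatialDecay ((fun t : ℝ => v₂ (t + 1)) 0) := by rw [hv₂'0]; exact hW0
  -- ### the constants: second derivatives at the final time, Landau step, margins
  obtain ⟨K, hK⟩ := PerturbedRun.exists_uniform_final_iteratedFDeriv_two_bound M Wd hM hWd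
  have hs0 := (Literature.Claims.NS.ClayVariants.isSmoothOnHalfSpace_zero
    (E := EuclideanSpace ℝ (Fin 3)) (F := EuclideanSpace ℝ (Fin 3)))
  have hd0 := (Literature.Claims.NS.ClayVariants.hasRapidSpaceTimeDecay_zero
    (E := EuclideanSpace ℝ (Fin 3)) (F := EuclideanSpace ℝ (Fin 3)))
  have hz0 : ∀ t : ℝ, Wd / 2 ≤ t → ∀ x : EuclideanSpace ℝ (Fin 3),
      (0 : ℝ → EuclideanSpace ℝ (Fin 3) → EuclideanSpace ℝ (Fin 3)) t x = 0 := fun _ _ _ => rfl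
  set Kp : ℝ := max K 0 with hKp
  have hKp0 : 0 ≤ Kp := le_max_right _ _
  have hKKp : K ≤ Kp := le_max_left _ _
  set h : ℝ := η / (8 * Kp + 1) with hh_def
  have hh : 0 < h := by positivity
  have hKh : (Kp + Kp) * h ≤ η / 4 := sup_aux_Kh hη hKp0
  set θ : ℝ := min (η / 4) (min (η * h / 16) (η / (4 * (L + 1)))) with hθ_def
  have hθpos : 0 < θ := lt_min (by positivity) (lt_min (by positivity) (by positivity))
  have hθ1 : θ ≤ η / 4 := min_le_left _ _
  have hθ2 : θ ≤ η * h / 16 := (min_le_right _ _).trans (min_le_left _ _)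
  have hθ3 : θ ≤ η / (4 * (L + 1)) := (min_le_right _ _).trans (min_le_right _ _)
  have hθL : 2 * θ * L ≤ η / 2 := sup_aux_θL hL0 hθpos.le hθ3
  -- the stability constant and the tail level
  set C₀ : ℝ := oseenSliceConst (EuclideanSpace ℝ (Fin 3)) with hC₀
  have hC₀pos : 0 < C₀ := oseenSliceConst_pos
  set lam : ℝ := 36 * C₀ ^ 2 * (M + (M + 1)) ^ 2 / 1 with hlam_def
  have hlam0 : 0 ≤ lam := by positivity
  set Λ : ℝ := 2 * (2 * (C₀ * (2 * (M - η)) * (2 * Real.sqrt Wd))) * Real.exp (lam * Wd) with hΛ_def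
  have hΛ0 : 0 ≤ Λ := by
    have h1 : 0 ≤ 2 * (M - η) := by linarith
    have h2 : 0 ≤ C₀ * (2 * (M - η)) * (2 * Real.sqrt Wd) :=
      mul_nonneg (mul_nonneg hC₀pos.le h1) (by positivity)
    have h3 : 0 ≤ Real.exp (lam * Wd) := (Real.exp_pos _).le
    exact mul_nonneg (mul_nonneg zero_le_two (mul_nonneg zero_le_two h2)) h3
  set θ₂ : ℝ := min (1 / 2) θ with hθ₂_def
  have hθ₂pos : 0 < θ₂ := lt_min (by norm_num) hθpos
  have hθ₂1 : θ₂ ≤ 1 / 2 := min_le_left _ _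
  have hθ₂2 : θ₂ ≤ θ := min_le_right _ _
  set ηt : ℝ := θ₂ / (Λ + 1) with hηt_def
  have hηt0 : 0 < ηt := by positivity
  have hΛη : Λ * ηt ≤ θ₂ := sup_aux_cθ hΛ0 hθ₂pos.le
  have hηtθ : ηt ≤ θ := (sup_aux_div_le hΛ0 hθ₂pos.le).trans (min_le_right _ _)
  have hηt4 : ηt ≤ η / 4 := hηtθ.trans hθ1
  -- ### the tails of the two free runs (uniform spatial decay)
  obtain ⟨ρa, hρa⟩ := hv₁'.exists_forall_norm_le_of_datum_decay hWd hv₁'E (by linarith : 0 < M + 1 / 2)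
    hv₁'M hdec₁ hηt0
  obtain ⟨ρb, hρb⟩ := hv₂'.exists_forall_norm_le_of_datum_decay hWd hv₂'E (by linarith : 0 < M + 1 / 2)
    hv₂'M hdec₂ hηt0
  set ρs : ℝ := max (max ρa ρb) 0 with hρs
  have hρs0 : 0 ≤ ρs := le_max_right _ _
  have htail₁ : ∀ t ∈ Icc 0 Wd, ∀ y, ρs ≤ ‖y‖ → ‖v₁ (t + 1) y‖ ≤ ηt := fun t ht y hy =>
    hρa t ht y (((le_max_left _ _).trans (le_max_left _ _)).trans hy)
  have htail₂ : ∀ t ∈ Icc 0 Wd, ∀ y, ρs ≤ ‖y‖ → ‖v₂ (t + 1) y‖ ≤ ηt := fun t ht y hy =>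
    hρb t ht y (((le_max_right _ _).trans (le_max_left _ _)).trans hy)
  -- freeze the constants (no definitional unfolding below)
  clear_value Wd M L Kp h θ C₀ lam Λ θ₂ ηt ρs
  -- ### the static companion rule and the threshold
  obtain ⟨rs, hrs⟩ := h₁.exists_add_translate hW hdivW hWsupp hWlt hR
  refine ⟨max rs (max (2 * ρs) (ρs + R + h + 1 / TowerRates.wide.N 1 + 1)), fun c hc => ?_⟩
  have hcs : rs ≤ ‖c‖ := (le_max_left _ _).trans hc
  have hc2 : 2 * ρs ≤ ‖c‖ := ((le_max_left _ _).trans (le_max_right _ _)).trans hc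
  have hcfar : ρs + R + h + 1 / TowerRates.wide.N 1 + 1 ≤ ‖c‖ :=
    ((le_max_right _ _).trans (le_max_right _ _)).trans hc
  have hLZ : LevelZeroData (U₁ + fun x => W (x - c)) (‖c‖ + R) := hrs c hcs
  refine ⟨hLZ, ?_⟩
  -- points near the amplifier are far from the carrier
  have hfar_pt : ∀ z : EuclideanSpace ℝ (Fin 3), ‖z - c‖ ≤ R + h + 1 / TowerRates.wide.N 1 → ρs ≤ ‖z‖ := by
    intro z hz
    have h1 : ‖c‖ ≤ ‖c - z‖ + ‖z‖ := norm_le_norm_sub_add c z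
    rw [norm_sub_rev] at h1
    linarith
  -- ### the superposition `ṽ = v₁' + v₂'(· − c)`: bound, remainder, smallness
  have hsbd : ∀ t ∈ Icc 0 Wd, ∀ x, ‖v₁ (t + 1) x + v₂ (t + 1) (x - c)‖ ≤ M - η + ηt := by
    intro t ht x
    have := SuperposedRun.norm_superposed_le (v₁ := fun t => v₁ (t + 1)) (v₂ := fun t => v₂ (t + 1))
      hv₁'bd hv₂'bd c htail₁ htail₂ hc2 ht x
    refine this.trans ?_
    rw [max_le_iff]; constructor <;> linarith
  have hsM : ∀ t ∈ Icc 0 Wd, ∀ x, ‖v₁ (t + 1) x + v₂ (t + 1) (x - c)‖ ≤ M := fun t ht x =>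
    (hsbd t ht x).trans (by linarith)
  set F : ℝ := 2 * (C₀ * (ηt * (M - η) + (M - η) * ηt) * (2 * Real.sqrt Wd)) with hF_def
  have hF0 : 0 ≤ F := by
    have h0 : 0 ≤ ηt * (M - η) := mul_nonneg hηt0.le hMη.le
    have h0' : 0 ≤ (M - η) * ηt := mul_nonneg hMη.le hηt0.le
    have h2 : 0 ≤ C₀ * (ηt * (M - η) + (M - η) * ηt) * (2 * Real.sqrt Wd) :=
      mul_nonneg (mul_nonneg hC₀pos.le (add_nonneg h0 h0')) (by positivity)
    exact mul_nonneg zero_le_two h2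
  clear_value F
  have hF : ∀ t ∈ Ioc 0 Wd, ∀ x,
      ‖oseenDuhamel 1 0 (fun t x => v₁ (t + 1) x + v₂ (t + 1) (x - c))
          (fun t x => v₁ (t + 1) x + v₂ (t + 1) (x - c)) t x -
        oseenDuhamel 1 0 (fun t => v₁ (t + 1)) (fun t => v₁ (t + 1)) t x -
        oseenDuhamel 1 0 (fun t x => v₂ (t + 1) (x - c)) (fun t x => v₂ (t + 1) (x - c)) t x‖ ≤ F := by
    intro t ht x
    rw [hF_def, hC₀]
    exact SuperposedRun.norm_superposedRemainder_le (v₁ := fun t => v₁ (t + 1))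
      (v₂ := fun t => v₂ (t + 1)) hv₁' hMη hv₁'bd hv₂' hMη hv₂'bd c hηt0.le hηt0.le htail₁ htail₂ hc2 ht x
  have h2F : 2 * F * Real.exp (lam * Wd) = Λ * ηt := by
    rw [hF_def, hΛ_def]; ring
  have hsmall : 2 * F * Real.exp (36 * oseenSliceConst (EuclideanSpace ℝ (Fin 3)) ^ 2 *
      (M + (M + 1)) ^ 2 / 1 * Wd) ≤ 1 / 2 := by
    rw [← hC₀, ← hlam_def, h2F]
    exact hΛη.trans hθ₂1
  have hsmallθ : 2 * F * Real.exp (lam * Wd) ≤ θ₂ := by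
    rw [h2F]; exact hΛη
  -- ### the superposed datum
  have hdat : (fun x => (fun t : ℝ => v₁ (t + 1)) 0 x + (fun t : ℝ => v₂ (t + 1)) 0 (x - c)) =
      U₁ + fun x => W (x - c) := by
    funext x
    simp only [zero_add, hv₁1, hv₂1, Pi.add_apply]
  have h0 : HasRapidSpatialDecay
      (fun x => (fun t : ℝ => v₁ (t + 1)) 0 x + (fun t : ℝ => v₂ (t + 1)) 0 (x - c)) := by
    rw [hdat]; exact HasRapidSpatialDecay.of_hasCompactSupport hLZ.smooth hLZ.hasCompactSupport
  have hdiv0 : VectorCalculus.IsDivFree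
      (fun x => (fun t : ℝ => v₁ (t + 1)) 0 x + (fun t : ℝ => v₂ (t + 1)) 0 (x - c)) := by
    rw [hdat]; exact hLZ.divFree
  -- ### THE SUPERPOSED RUN on `[0, Wd]`
  obtain ⟨u', p', hcl', hu'0, hE', hclose⟩ :=
    SuperposedRun.exists_free_run_near_superposed (v₁ := fun t => v₁ (t + 1)) (v₂ := fun t => v₂ (t + 1))
      hWd hv₁' hv₁'E hMη hv₁'bd hv₂' hv₂'E hMη hv₂'bd c hM hsM hF0 hF hsmall h0 hdiv0
  -- closeness `≤ θ₂ ≤ θ` on the whole window, and the bound `M + 1/2`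
  have hcloseθ₂ : ∀ t ∈ Icc 0 Wd, ∀ x, ‖u' t x - (v₁ (t + 1) x + v₂ (t + 1) (x - c))‖ ≤ θ₂ := by
    intro t ht x
    refine (hclose t ht x).trans ?_
    have h1 : Real.exp (36 * oseenSliceConst (EuclideanSpace ℝ (Fin 3)) ^ 2 * (M + (M + 1)) ^ 2 / 1 * t) ≤
        Real.exp (lam * Wd) := by
      rw [← hC₀, ← hlam_def]
      exact Real.exp_le_exp.2 (mul_le_mul_of_nonneg_left ht.2 hlam0)
    exact (mul_le_mul_of_nonneg_left h1 (by positivity)).trans hsmallθ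
  have hcloseθ : ∀ t ∈ Icc 0 Wd, ∀ x, ‖u' t x - (v₁ (t + 1) x + v₂ (t + 1) (x - c))‖ ≤ θ :=
    fun t ht x => (hcloseθ₂ t ht x).trans hθ₂2
  have hu'bd : ∀ t ∈ Icc 0 Wd, ∀ x, ‖u' t x‖ ≤ M + 1 / 2 := by
    intro t ht x
    have h1 := hcloseθ₂ t ht x
    have h2 := hsM t ht x
    calc ‖u' t x‖ = ‖(v₁ (t + 1) x + v₂ (t + 1) (x - c)) + (u' t x - (v₁ (t + 1) x + v₂ (t + 1) (x - c)))‖ := by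
          rw [add_sub_cancel]
      _ ≤ ‖v₁ (t + 1) x + v₂ (t + 1) (x - c)‖ + ‖u' t x - (v₁ (t + 1) x + v₂ (t + 1) (x - c))‖ :=
          norm_add_le _ _
      _ ≤ M + 1 / 2 := by linarith
  -- ### second derivatives at the final time
  have hWmem : Wd ∈ Icc 0 Wd := ⟨hWd.le, le_rfl⟩
  have hu'0' : HasRapidSpatialDecay (u' 0) := by rw [hu'0]; exact h0
  have hKu : ∀ x, ‖iteratedFDeriv ℝ 2 (u' Wd) x‖ ≤ Kp := fun x =>
    (hK hs0 hd0 hz0 hcl' hE' hu'0' hu'bd x).trans hKKp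
  have hK₂ : ∀ x, ‖iteratedFDeriv ℝ 2 ((fun t : ℝ => v₂ (t + 1)) Wd) x‖ ≤ Kp := fun x =>
    (hK hs0 hd0 hz0 hv₂' hv₂'E hv₂'0' hv₂'M x).trans hKKp
  -- ### shift back to `[1, τfirst]`: `w t = u' (t − 1)`
  set w : ℝ → EuclideanSpace ℝ (Fin 3) → EuclideanSpace ℝ (Fin 3) := fun t => u' (t + -1) with hw_def
  set r : ℝ → EuclideanSpace ℝ (Fin 3) → ℝ := fun t => p' (t + -1) with hr_def
  have hmemI : ∀ {t : ℝ}, t ∈ Icc (1 : ℝ) Host.τfirst → t + -1 ∈ Icc 0 Wd := fun ht =>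
    ⟨by linarith [ht.1], by rw [hτ] at ht; linarith [ht.2]⟩
  have hwsol : IsClassicalNSSolutionOn (Icc 1 Host.τfirst) 1 0 w r := by
    have h1 : IsClassicalNSSolutionOn (Icc 1 Host.τfirst) 1
        (fun t => (0 : ℝ → EuclideanSpace ℝ (Fin 3) → EuclideanSpace ℝ (Fin 3)) (t + -1)) w r :=
      (hcl'.comp_add_right (-1)).mono (fun t ht => hmemI ht) (uniqueDiffOn_Icc (by rw [hτ]; linarith))
    exact h1
  have hwτ : w Host.τfirst = u' Wd := by
    show u' (Host.τfirst + -1) = u' Wd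
    rw [hτ]; ring_nf
  have hvτ : v₂ Host.τfirst = v₂ (Wd + 1) := by rw [hτ, add_comm]
  have hv₁τ : v₁ Host.τfirst = v₁ (Wd + 1) := by rw [hτ, add_comm]
  -- the closeness at the final time, in unshifted notation
  have hcloseW : ∀ x, ‖u' Wd x - (v₁ (Wd + 1) x + v₂ (Wd + 1) (x - c))‖ ≤ θ := fun x => hcloseθ Wd hWmem x
  have htail₁W : ∀ y, ρs ≤ ‖y‖ → ‖v₁ (Wd + 1) y‖ ≤ ηt := fun y hy => htail₁ Wd hWmem y hy
  refine ⟨w, r, hwsol, ?_, ?_, ?_, ?_, ?_, ?_⟩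
  · -- `w 1 = U₁ + W(· − c)`
    show u' (1 + -1) = U₁ + fun x => W (x - c)
    rw [add_neg_cancel, hu'0]
    funext y
    simp only [zero_add, hv₁1, hv₂1, Pi.add_apply]
  · -- energy
    obtain ⟨C, hC, hb⟩ := hE'
    exact ⟨C, hC, fun t ht => hb (t + -1) (hmemI ht)⟩
  · -- the cap with margin `η/2`
    intro t ht x
    have h1 := hcloseθ (t + -1) (hmemI ht) x
    have h2 := hsbd (t + -1) (hmemI ht) x
    have h3 : t + -1 + 1 = t := by ring
    rw [h3] at h1 h2
    calc ‖w t x‖ = ‖(v₁ t x + v₂ t (x - c)) + (u' (t + -1) x - (v₁ t x + v₂ t (x - c)))‖ := by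
          rw [add_sub_cancel]
      _ ≤ ‖v₁ t x + v₂ t (x - c)‖ + ‖u' (t + -1) x - (v₁ t x + v₂ t (x - c))‖ := norm_add_le _ _
      _ ≤ (M - η + ηt) + θ := add_le_add h2 h1
      _ ≤ M - η / 2 := by linarith
  · -- the speed floor at `x + c`
    obtain ⟨x, hx, hfl⟩ := hspeed
    refine ⟨x + c, by linarith [norm_add_le x c], ?_⟩
    rw [hwτ]
    rw [hvτ] at hfl
    have h1 := hcloseW (x + c)
    rw [add_sub_cancel_right] at h1
    have hxc : ρs ≤ ‖x + c‖ := hfar_pt (x + c) (by rw [add_sub_cancel_right]; linarith [hh.le,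
      (by positivity : (0 : ℝ) ≤ 1 / TowerRates.wide.N 1)])
    have h2 := htail₁W (x + c) hxc
    have h3 : ‖v₂ (Wd + 1) x‖ ≤ ‖u' Wd (x + c)‖ + ‖u' Wd (x + c) - (v₁ (Wd + 1) (x + c) + v₂ (Wd + 1) x)‖ +
        ‖v₁ (Wd + 1) (x + c)‖ := by
      calc ‖v₂ (Wd + 1) x‖
          = ‖u' Wd (x + c) - (u' Wd (x + c) - (v₁ (Wd + 1) (x + c) + v₂ (Wd + 1) x)) - v₁ (Wd + 1) (x + c)‖ := by
            congr 1; abel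
        _ ≤ ‖u' Wd (x + c) - (u' Wd (x + c) - (v₁ (Wd + 1) (x + c) + v₂ (Wd + 1) x))‖ +
            ‖v₁ (Wd + 1) (x + c)‖ := norm_sub_le _ _
        _ ≤ _ := by gcongr; exact norm_sub_le _ _
    linarith
  · -- the strain floor at `x + c` (local Landau on `u'(Wd) − v₂'(Wd)(· − c)`, `strain_face_transfer`)
    obtain ⟨x, hx, hst⟩ := hstrain
    refine ⟨x + c, by linarith [norm_add_le x c], ?_⟩
    rw [hwτ]
    rw [hvτ] at hst
    have h2u : ContDiff ℝ 2 (u' Wd) := (hcl'.contDiff_velocity hWmem).of_le (by norm_cast)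
    have h2v₂ : ContDiff ℝ 2 (v₂ (Wd + 1)) := by
      have := (hv₂'.contDiff_velocity hWmem).of_le (m := 2) (by norm_cast)
      simpa using this
    have hK₂' : ∀ z, ‖iteratedFDeriv ℝ 2 (v₂ (Wd + 1)) z‖ ≤ Kp := fun z => by simpa using hK₂ z
    have htailball : ∀ z ∈ closedBall (x + c) h, ‖v₁ (Wd + 1) z‖ ≤ ηt := by
      intro z hz
      refine htail₁W z (hfar_pt z ?_)
      rw [mem_closedBall, dist_eq_norm] at hz
      have : ‖z - c‖ ≤ ‖z - (x + c)‖ + ‖x‖ := by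
        calc ‖z - c‖ = ‖(z - (x + c)) + x‖ := by congr 1; abel
          _ ≤ ‖z - (x + c)‖ + ‖x‖ := norm_add_le _ _
      have hN : (0 : ℝ) ≤ 1 / TowerRates.wide.N 1 := by positivity
      linarith
    have herr : 2 * (θ + ηt) / h + (Kp + Kp) * h ≤ η / 2 := sup_aux_err hh hθ2 hηtθ hKh
    exact strain_face_transfer (r := v₁ (Wd + 1)) h2u h2v₂ hh hcloseW htailball hKu hK₂' herr hst
  · -- the core loop, translated by `c` (`core_face_transfer`)
    obtain ⟨x, γ, hx, hγ, hγ01, hγball, hγspeed, hcirc⟩ := hcore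
    refine ⟨x + c, fun s => γ s + c, by linarith [norm_add_le x c], hγ.add contDiff_const,
      by simp only [hγ01], fun s hs => ?_, fun s hs => ?_, ?_⟩
    · have := hγball s hs
      rw [mem_closedBall, dist_eq_norm] at this ⊢
      calc ‖γ s + c - (x + c)‖ = ‖γ s - x‖ := by congr 1; abel
        _ ≤ _ := this
    · rw [deriv_add_const]; exact hγspeed s hs
    rw [hwτ]
    rw [hvτ] at hcirc
    have hcu : Continuous (u' Wd) := (hcl'.contDiff_velocity hWmem).continuous
    have hcv₁ : Continuous (v₁ (Wd + 1)) := by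
      have := (hv₁'.contDiff_velocity hWmem).continuous; simpa using this
    have hcv₂ : Continuous (v₂ (Wd + 1)) := by
      have := (hv₂'.contDiff_velocity hWmem).continuous; simpa using this
    -- the loop stays far from the carrier
    have hγtail : ∀ s ∈ Icc (0 : ℝ) 1, ‖v₁ (Wd + 1) (γ s + c)‖ ≤ ηt := by
      intro s hs
      refine htail₁W (γ s + c) (hfar_pt (γ s + c) ?_)
      have h1 := hγball s hs
      rw [mem_closedBall, dist_eq_norm] at h1
      have h2 : ‖γ s + c - c‖ ≤ ‖γ s - x‖ + ‖x‖ := by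
        calc ‖γ s + c - c‖ = ‖(γ s - x) + x‖ := by congr 1; abel
          _ ≤ ‖γ s - x‖ + ‖x‖ := norm_add_le _ _
      linarith [hh.le]
    have h3 : ηt * L + θ * L ≤ η / 2 := by
      have := mul_le_mul_of_nonneg_right hηtθ hL0
      linarith
    exact core_face_transfer (r := v₁ (Wd + 1)) hcu hcv₂ hcv₁ hγ hL0 hγspeed hcloseW hγtail h3 hcirc

end Summit.NavierStokesRegularity.FluidComputer.PalasekTowerClayBridge.Germ

end
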